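import Mathlib.Geometry.Manifold.PartitionOfUnity
import Mathlib.Geometry.Manifold.ContMDiff.NormedSpace
import Literature.Geometry.Symplectic.TamingWitness
import Literature.Geometry.Symplectic.GromovR4StdModel
import Literature.Geometry.Kaehler.ManifoldFormsChart
import Literature.Geometry.Kaehler.ManifoldFormsFunSmulProofs
import HarnessLib

/-!
# Route SullivanDual, item `WitnessChargesCocores` (stmt-SmoothPoincare4-8126): the handle-free
# kernel — taming witnesses are not carried by exact-tamed (e.g. `J`-convex) regions

Problem `SmoothPoincare4`, route `SullivanDual`, support item stmt-SmoothPoincare4-8126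
`WitnessChargesCocores` (filed INFORMALLY, no Lean statement in
`Summits/SmoothPoincare4/SmoothPoincare4/Theses/SullivanDual.lean` rev 2: "in a handle
presentation of the homotopy ball `K = Σ ∖ B`, every taming witness charges the co-cores of the
2-handles attached with framing `≥ tb`"). This file proves, sorry-free and in the tree's
vocabulary (`Literature.Geometry.Symplectic.TamingWitness`), the functional-analytic KERNEL that
any formal version of that claim rests on — the localised "Stein ⇒ no witnesses" maximum
principle for relative Sullivan structure currents:

* `tamingWitness_eq_of_eqOn_offBall` — a witness at radius `ε` is DETERMINED BY THE VALUES OF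
  FORMS OFF THE BALL: once some smooth form tames `J` off the punctured `ε`-ball, `T α₁ = T α₂`
  whenever the smooth forms `α₁, α₂` agree off the ball ((W1) by scaling,
  `TamingWitness.eq_zero_of_vanishes_off_ball`).
* `tamingWitness_nonneg_of_semipos` — a witness is a POSITIVE functional: `T α ≥ 0` for every
  smooth `α` that is `J`-semipositive off the ball.
* `tamingWitness_false_of_carried` — the algebraic kernel: if `T` is carried by a set `C`
  (`T α₁ = T α₂` for smooth forms agreeing on `C`) and some smooth form taming `J` off the ball
  agrees on `C` with a smooth CLOSED form vanishing on the ball, then (W1) `> 0` and (W2) `= 0`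
  collide.
* `exists_tamesOffBall_eqOn` — GLUING (smooth Urysohn function on the punctured manifold,
  Mathlib `exists_contMDiffMap_zero_one_of_isClosed`): a smooth form taming `J` on an open
  `U ⊇ C`, `C` closed, and a smooth form taming `J` off the ball glue to a smooth form taming `J`
  off the ball and equal to the first on `C`.
* `tamingWitness_not_carried_of_exactTamed` — THE KERNEL: if a smooth `1`-form `ψ` has `dψ = 0`
  on the punctured `ε`-ball and `dψ` TAMES `J` on an open set `U` (off the ball), then NO taming
  witness at radius `ε` is carried by a closed subset of `U`. With `ψ = -dφ ∘ J` this hypothesis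
  is exactly `J`-convexity of `φ` on `U` in the tree's convention
  (`Literature.Geometry.Symplectic.SteinStructure.convex`: `0 < -(d(dφ ∘ J))(v, Jv)`), so:
  no witness lives inside a `J`-convex region reaching down to the collar.
* `tamingWitness_charges_of_exactTamed` — the same in "charging" form: if the complement of an
  open set `N` off the ball lies in such a `U`, every witness CHARGES `N` — there is a smooth
  `2`-form vanishing off the ball outside `N` with `T α ≠ 0`.

How the informal item follows (for the planner's restatement; NOT formalised here — the tree
has no handle decompositions with Legendrian attaching data): if `J` is chosen `J`-convex
(exact-tamed by `dψ`, `ψ = 0` on the ball) on an open region `U` of `Σ ∖ p` containing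
`K_ε ∖ N`, `N` = an open neighbourhood of the co-core discs of the over-framed 2-handles together
with a thin annulus at the collar sphere (Eliashberg–Gompf Stein structure on the sub-handlebody
of 0-, 1- and `tb - 1`-framed 2-handles, engulfing the complement of the co-cores), then by
`tamingWitness_charges_of_exactTamed` every witness charges `N`; the collar annulus carries no
mass by the collar lemma of the sibling crux line (`stub_collar`, Cruxes/WitnessCharge), leaving
the co-core neighbourhoods. The hypothesis the argument really uses is EXACT TAMING
(`J`-convexity) of the region, not Brody hyperbolicity of the model structure on the 0- and
1-handles as the informal text has it — see the seat's release note on stmt-SmoothPoincare4-8126.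

References: D. Sullivan, Invent. Math. 36 (1976), Thm. I.7 and §II (structure currents,
Hahn–Banach alternative) [Sullivan1976]; Ya. Eliashberg, *Filling by holomorphic discs and its
applications* (1990), §1.1 (maximum principle for `J`-convex functions) [Eliashberg1990];
K. Cieliebak, Ya. Eliashberg, *From Stein to Weinstein and back* (2012), Ch. 2
[CieliebakEliashberg2012]; R. Gompf, Ann. of Math. 148 (1998), §1 [Gompf1998].
-/

noncomputable section

-- the registered namespace `Summit.SmoothPoincare4.SmoothPoincare4.Theorems` repeats a component
set_option linter.dupNamespace false

open scoped Manifold ContDiff Topology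
open Set Filter Literature.Geometry.Kaehler Literature.Geometry.Symplectic

namespace Summit.SmoothPoincare4.SmoothPoincare4.Theorems.SullivanDual

variable {M : Type*} [TopologicalSpace M] [ChartedSpace (EuclideanSpace ℝ (Fin 4)) M] [T1Space M]
  {p : M} {ε : ℝ}
  {J : ∀ x : punctured p, TangentSpace (𝓡 4) x →L[ℝ] TangentSpace (𝓡 4) x}
  {T : MForm (𝓡 4) (punctured p) ℝ 2 →ₗ[ℝ] ℝ}

/-! ### §1 Witnesses are order-zero functionals carried by the complement of the ball -/

/-- **A taming witness is determined by the values of forms off the ball.** If some smooth form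
`β` tames `J` off the punctured `ε`-ball, then `T α₁ = T α₂` for all smooth `2`-forms agreeing at
every point NOT in the punctured `ε`-ball (their difference vanishes off the ball and is killed,
`TamingWitness.eq_zero_of_vanishes_off_ball`). Sullivan (1976), §I (structure currents are
supported on the compact piece). [cite: Sullivan1976, Thm. I.7] -/
theorem tamingWitness_eq_of_eqOn_offBall (h : TamingWitness p ε J T)
    {β : MForm (𝓡 4) (punctured p) ℝ 2} (hβ : IsSmoothForm β) (hβt : TamesOffBall p ε J β)
    {α₁ α₂ : MForm (𝓡 4) (punctured p) ℝ 2} (h₁ : IsSmoothForm α₁) (h₂ : IsSmoothForm α₂)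
    (heq : ∀ x : punctured p, ¬ InPuncturedChartBall p ε x → α₁ x = α₂ x) : T α₁ = T α₂ := by
  have h0 : T (α₁ + (-1 : ℝ) • α₂) = 0 :=
    h.eq_zero_of_vanishes_off_ball hβ hβt (h₁.add (h₂.smul (-1))) fun x hx => by
      simp [heq x hx]
  rw [map_add, map_smul, smul_eq_mul] at h0
  linarith

/-- **A taming witness is a positive functional**: if some smooth `β` tames `J` off the ball and
the smooth form `α` is `J`-SEMIPOSITIVE off the ball (`α_x(v, J v) ≥ 0`), then `0 ≤ T α`
(`β + t • α` tames `J` off the ball for every `t > 0`). Sullivan (1976), §I.4 (structure currents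
are positive on the closed cone). [cite: Sullivan1976, Thm. I.7] -/
theorem tamingWitness_nonneg_of_semipos (h : TamingWitness p ε J T)
    {β : MForm (𝓡 4) (punctured p) ℝ 2} (hβ : IsSmoothForm β) (hβt : TamesOffBall p ε J β)
    {α : MForm (𝓡 4) (punctured p) ℝ 2} (hα : IsSmoothForm α)
    (hα0 : ∀ x : punctured p, ¬ InPuncturedChartBall p ε x →
      ∀ v : TangentSpace (𝓡 4) x, 0 ≤ α x ![v, J x v]) :
    0 ≤ T α := by
  by_contra hneg'
  have hneg : T α < 0 := not_le.mp hneg'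
  have hβpos : 0 < T β := h.pos_of_tames hβ hβt
  have hTa : T α ≠ 0 := hneg.ne
  set t : ℝ := (T β + 1) / (-(T α)) with ht
  have htpos : 0 < t := div_pos (by linarith) (by linarith)
  have htame : TamesOffBall p ε J (β + t • α) := fun x hx v hv => by
    have hb := hβt x hx v hv
    have ha := hα0 x hx v
    simp only [Pi.add_apply, Pi.smul_apply, ContinuousAlternatingMap.add_apply,
      ContinuousAlternatingMap.smul_apply, smul_eq_mul]
    nlinarith
  have hpos := h.pos_of_tames (hβ.add (hα.smul t)) htame
  rw [map_add, map_smul, smul_eq_mul] at hpos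
  have hmul : t * T α = -(T β + 1) := by
    rw [ht, div_mul_eq_mul_div, div_eq_iff (neg_ne_zero.2 hTa)]
    ring
  linarith

/-! ### §2 The algebraic kernel: (W1) and (W2) collide on a carried set -/

/-- **Kernel, algebraic form.** Let `T` be a taming witness at radius `ε`, CARRIED by a set `C`
(it cannot distinguish smooth forms that agree on `C`). If a smooth closed form `γ` vanishing on
the punctured `ε`-ball and a smooth form `α` taming `J` off the ball agree on `C`, we reach a
contradiction: `T γ = 0` by (W2), `T α > 0` by (W1), `T α = T γ` by carriage. This is Sullivan's
"no structure cycle is annihilated by a transversal form", relative version.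
[cite: Sullivan1976, Thm. I.7] -/
theorem tamingWitness_false_of_carried (h : TamingWitness p ε J T) {C : Set (punctured p)}
    (hC : ∀ α₁ α₂ : MForm (𝓡 4) (punctured p) ℝ 2, IsSmoothForm α₁ → IsSmoothForm α₂ →
      (∀ x ∈ C, α₁ x = α₂ x) → T α₁ = T α₂)
    {γ : MForm (𝓡 4) (punctured p) ℝ 2} (hγ : IsSmoothForm γ) (hγc : IsClosedForm γ)
    (hγ0 : ∀ x : punctured p, InPuncturedChartBall p ε x → γ x = 0)
    {α : MForm (𝓡 4) (punctured p) ℝ 2} (hα : IsSmoothForm α) (hαt : TamesOffBall p ε J α)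
    (hagree : ∀ x ∈ C, α x = γ x) : False := by
  have h1 : T γ = 0 := h.eq_zero_of_vanishes hγ hγc hγ0
  have h2 : 0 < T α := h.pos_of_tames hα hαt
  have h3 : T α = T γ := hC α γ hα hγ hagree
  linarith

/-! ### §3 Gluing taming forms by a smooth Urysohn function -/

section Glue

variable [T2Space M] [SecondCountableTopology M] [IsManifold (𝓡 4) ∞ M]

/-- **Gluing.** On the punctured manifold let `C ⊆ U`, `C` closed, `U` open; let the smooth form
`γ` tame `J` at the points of `U` off the ball and let the smooth form `β` tame `J` off the ball
everywhere. Then some smooth form tames `J` off the ball and equals `γ` on `C`: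
`α = f • γ + (1 - f) • β` with `f` a smooth Urysohn function, `f = 1` on `C`, `f = 0` off `U`,
`0 ≤ f ≤ 1` (Mathlib `exists_contMDiffMap_zero_one_of_isClosed` on the σ-compact open
submanifold `M ∖ p`); pointwise a convex combination of taming values is taming.
[cite: LeeSmoothManifolds2013, Thm. 2.23] -/
theorem exists_tamesOffBall_eqOn {C U : Set (punctured p)} (hCc : IsClosed C) (hU : IsOpen U)
    (hCU : C ⊆ U) {γ : MForm (𝓡 4) (punctured p) ℝ 2} (hγ : IsSmoothForm γ)
    (hγt : ∀ x ∈ U, ¬ InPuncturedChartBall p ε x →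
      ∀ v : TangentSpace (𝓡 4) x, v ≠ 0 → 0 < γ x ![v, J x v])
    {β : MForm (𝓡 4) (punctured p) ℝ 2} (hβ : IsSmoothForm β) (hβt : TamesOffBall p ε J β) :
    ∃ α : MForm (𝓡 4) (punctured p) ℝ 2, IsSmoothForm α ∧ TamesOffBall p ε J α ∧
      ∀ x ∈ C, α x = γ x := by
  haveI : LocallyCompactSpace (punctured p) :=
    Manifold.locallyCompact_of_finiteDimensional (𝓡 4)
  obtain ⟨f, hf0, hf1, hf01⟩ := exists_contMDiffMap_zero_one_of_isClosed (𝓡 4) (n := (⊤ : ℕ∞))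
    hU.isClosed_compl hCc (disjoint_compl_left_iff.2 hCU)
  have hfs : ContMDiff (𝓡 4) 𝓘(ℝ, ℝ) ∞ (f : punctured p → ℝ) := f.contMDiff
  have hgs : ContMDiff (𝓡 4) 𝓘(ℝ, ℝ) ∞ (fun x : punctured p => 1 - f x) :=
    (contDiff_const.sub contDiff_id).comp_contMDiff hfs
  refine ⟨(f : punctured p → ℝ) • γ + (fun x : punctured p => 1 - f x) • β,
    (hγ.fun_smul' hfs).add (hβ.fun_smul' hgs), ?_, ?_⟩
  · intro x hx v hv
    have hb : 0 < β x ![v, J x v] := hβt x hx v hv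
    obtain ⟨h0, h1⟩ := hf01 x
    simp only [Pi.add_apply, Pi.smul_apply', ContinuousAlternatingMap.add_apply,
      ContinuousAlternatingMap.smul_apply, smul_eq_mul]
    by_cases hfx : f x = 0
    · rw [hfx]
      linarith
    · have hxU : x ∈ U := by
        by_contra hxU
        exact hfx (hf0 hxU)
      have hg : 0 < γ x ![v, J x v] := hγt x hxU hx v hv
      have hfpos : 0 < f x := lt_of_le_of_ne h0 (Ne.symm hfx)
      nlinarith
  · intro x hxC
    have hfx : f x = 1 := hf1 hxC
    simp only [Pi.add_apply, Pi.smul_apply', hfx, one_smul, sub_self, zero_smul, add_zero]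

/-! ### §4 The kernel: no witness is carried by an exact-tamed region -/

/-- **KERNEL of `WitnessChargesCocores` — taming witnesses are not carried by exact-tamed
regions.** Let `T` be a taming witness at radius `ε` for `J` on `M ∖ p`, and let some smooth
form tame `J` off the punctured `ε`-ball. Let `ψ` be a smooth `1`-form whose exterior derivative
VANISHES on the punctured `ε`-ball and TAMES `J` at every point of an open set `U` off the ball
(for `ψ = -dφ ∘ J` this says: `φ` is strictly `J`-convex on `U`, tree convention
`SteinStructure.convex`). Then `T` is carried by NO closed `C ⊆ U`: there are smooth `2`-forms
agreeing on `C` with different `T`-values. Proof: `dψ` is smooth and closed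
(`isSmoothForm_mextDeriv`, `mextDeriv_mextDeriv`), so (W2) gives `T (dψ) = 0`; gluing
(`exists_tamesOffBall_eqOn`) produces a smooth form taming `J` off the ball and equal to `dψ` on
`C`, on which (W1) gives `T > 0`. The localised maximum principle "a Stein region carries no
closed positive current" (Eliashberg (1990), §1.1; Sullivan (1976), Thm. I.7).
[cite: Sullivan1976, Thm. I.7] -/
theorem tamingWitness_not_carried_of_exactTamed (h : TamingWitness p ε J T)
    {β : MForm (𝓡 4) (punctured p) ℝ 2} (hβ : IsSmoothForm β) (hβt : TamesOffBall p ε J β)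
    {ψ : MForm (𝓡 4) (punctured p) ℝ 1} (hψ : IsSmoothForm ψ)
    (hψ0 : ∀ x : punctured p, InPuncturedChartBall p ε x → mextDeriv ψ x = 0)
    {U : Set (punctured p)} (hU : IsOpen U)
    (hψt : ∀ x ∈ U, ¬ InPuncturedChartBall p ε x →
      ∀ v : TangentSpace (𝓡 4) x, v ≠ 0 → 0 < mextDeriv ψ x ![v, J x v])
    {C : Set (punctured p)} (hCc : IsClosed C) (hCU : C ⊆ U) :
    ¬ (∀ α₁ α₂ : MForm (𝓡 4) (punctured p) ℝ 2, IsSmoothForm α₁ → IsSmoothForm α₂ →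
        (∀ x ∈ C, α₁ x = α₂ x) → T α₁ = T α₂) := by
  intro hC
  have hdψ : IsSmoothForm (mextDeriv ψ) :=
    isSmoothForm_mextDeriv (inChart_mextDeriv_holds (𝓡 4) (punctured p) ℝ) hψ
  have hddψ : IsClosedForm (mextDeriv ψ) :=
    mextDeriv_mextDeriv (inChart_mextDeriv_holds (𝓡 4) (punctured p) ℝ) hψ
  obtain ⟨α, hα, hαt, hagree⟩ := exists_tamesOffBall_eqOn hCc hU hCU hdψ hψt hβ hβt
  exact tamingWitness_false_of_carried h hC hdψ hddψ hψ0 hα hαt hagree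

/-- **Every taming witness CHARGES every open set `N` whose complement off the ball sits in an
exact-tamed region.** Under the hypotheses of `tamingWitness_not_carried_of_exactTamed` on
`ψ` and `U`, if `{x | x ∉ B_ε} ∖ N ⊆ U` for an open `N`, then some smooth `2`-form `α` vanishes
at every point off the ball outside `N` and has `T α ≠ 0` — the witness has mass in `N` (modulo
the ball, to which it is blind by `tamingWitness_eq_of_eqOn_offBall`). With `U` a `J`-convex
region engulfing the complement of the co-cores of the over-framed 2-handles and `N` a
neighbourhood of those co-cores plus a collar annulus, this is the informal claim of item
stmt-SmoothPoincare4-8126 (openness of the punctured ball: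
`Literature.Geometry.Symplectic.isOpen_setOf_inPuncturedChartBall`). [cite: Sullivan1976, Thm. I.7] -/
theorem tamingWitness_charges_of_exactTamed (h : TamingWitness p ε J T)
    {β : MForm (𝓡 4) (punctured p) ℝ 2} (hβ : IsSmoothForm β) (hβt : TamesOffBall p ε J β)
    {ψ : MForm (𝓡 4) (punctured p) ℝ 1} (hψ : IsSmoothForm ψ)
    (hψ0 : ∀ x : punctured p, InPuncturedChartBall p ε x → mextDeriv ψ x = 0)
    {U : Set (punctured p)} (hU : IsOpen U)
    (hψt : ∀ x ∈ U, ¬ InPuncturedChartBall p ε x →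
      ∀ v : TangentSpace (𝓡 4) x, v ≠ 0 → 0 < mextDeriv ψ x ![v, J x v])
    {N : Set (punctured p)} (hN : IsOpen N)
    (hNU : {x : punctured p | ¬ InPuncturedChartBall p ε x} \ N ⊆ U) :
    ∃ α : MForm (𝓡 4) (punctured p) ℝ 2, IsSmoothForm α ∧
      (∀ x : punctured p, ¬ InPuncturedChartBall p ε x → x ∉ N → α x = 0) ∧ T α ≠ 0 := by
  have hCc : IsClosed ({x : punctured p | ¬ InPuncturedChartBall p ε x} \ N) := by
    refine IsClosed.sdiff ?_ hN
    have : {x : punctured p | ¬ InPuncturedChartBall p ε x} =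
        {x : punctured p | InPuncturedChartBall p ε x}ᶜ := by
      ext x; simp
    rw [this]
    exact (isOpen_setOf_inPuncturedChartBall p ε).isClosed_compl
  by_contra hall
  refine tamingWitness_not_carried_of_exactTamed h hβ hβt hψ hψ0 hU hψt hCc hNU
    fun α₁ α₂ h₁ h₂ hagree => ?_
  by_contra hne
  refine hall ⟨α₁ + (-1 : ℝ) • α₂, h₁.add (h₂.smul (-1)), fun x hx hxN => ?_, fun h0 => hne ?_⟩
  · have hx' : α₁ x = α₂ x := hagree x ⟨hx, hxN⟩
    simp [hx']
  · rw [map_add, map_smul, smul_eq_mul] at h0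
    linarith

end Glue

end Summit.SmoothPoincare4.SmoothPoincare4.Theorems.SullivanDual
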